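/-
Copyright (c) 2026. Released under the Apache 2.0 license.
-/
import Literature.NumberTheory.EllipticCurves.ManinConstantLegendreTwistProofs
import Literature.NumberTheory.EllipticCurves.FormalMulTwoLowOrderProofs
import Literature.NumberTheory.EllipticCurves.DeuringFormValuation
import HarnessLib

/-!
# The Deuring twist at an additive prime `2`, `‖q‖₂ ≤ 1`, and Edixhoven's integrality of the
# Manin constant: the fact `edixhoven_int_of_neronLattice_eq_smul_periodLattice` holds

[Proofs] Theorems only (no definition, no named fact). This file closes the last case — a prime
`2` of potentially good additive reduction — of the local programme recorded in the docstring of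
`Literature.NumberTheory.EllipticCurves.edixhoven_int_of_neronLattice_eq_smul_periodLattice`
(`NeronIsogenyScaling.lean`) and DISCHARGES that fact (Edixhoven 1991, Prop. 2: for a globally
minimal elliptic `W'/ℚ` with a newform `f` and a Néron-type period pair whose lattice is exactly
`q·Λ_f`, the rational `q` is an integer), together with its verbatim twin
`Literature.NumberTheory.EllipticCurves.ModularForms.edixhoven_optimalManinConstant_integral`.

* `flex_smul_eq` — the Deuring (flex) normal form over any field: for a point `P = (x₀, y₀)` of
  `W` with `Ψ₃(x₀) = 0` and `D = a₃ + x₀a₁ + 2y₀ ≠ 0`, the change `(1, x₀, N/D, y₀)`,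
  `N = a₄ + 2x₀a₂ − y₀a₁ + 3x₀²`, gives `y² + (a₁ + 2N/D)xy + Dy = x³` (the identities
  `a₄' = 0`, `a₆' = −(equation)`, `D²a₂' = (b₂ + 12x₀)·(equation) + Ψ₃(x₀)`); `Ψ₃_bezout`
  (`A·Ψ₃ − B·Ψ₂² = Δ`, so `D ≠ 0` when `Δ ≠ 0`), `sq_ψ₂_eq`, `uScale_smul_deuringForm`; the invariants `c₄ = A₁(A₁³ − 24A₃)`,
  `Δ = A₃³(A₁³ − 27A₃)` are the tree's `threeTorsionForm_c₄/_Δ` (`DeuringFormValuation`).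
* `norm_le_one_of_Ψ₃_root`, `norm_le_one_of_monic_quadratic_root`,
  `norm_le_one_and_norm_sub_eq_one_of_deuring` (`‖t(t − 24)³‖ ≤ ‖t − 27‖`, `‖3‖ = 1` ⇒ `‖t‖ ≤ 1`,
  `‖t − 27‖ = 1`), `norm_pow_twelve_eq_of_deuring` — ultrametric lemmas.
* `exists_deuringData`, `exists_deuringTwist_of_norm_j_le_one` — THE DEURING TWIST at a prime
  `p ≠ 3` with `‖j‖_p ≤ 1`: a flex of `W'` in `ℚ̄_p`, `t = A₁³/D`, `j = t(t − 24)³/(t − 27)`,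
  `u₀¹² = Δ(W')` with `‖u₀‖³ = ‖D‖ ≥ ‖A₁‖³`; over `K = ℚ_p(x₀, y₀, u₀, p^{1/12})` (so `12 ∣ e`)
  the `O`-curve `V'' = (wA₁/u₀, 0, w³D/u₀³, 0, 0)` (`u₀ = wπᵏ`) has Deuring shape, good reduction,
  `V'' ⊗ K = (πᵏ, x₀, s₀, y₀) • (W' ⊗ K)` with `x₀, s₀, y₀ ∈ O`
  (`norm_rst_le_one_of_variableChange_eq`) and `12k = e·v_p(Δ_min)`.
* `coeff_two_formalMul_two_of_char_two` (`[z²][2] = a₁`), `coeff_four_formalMul_two_ne_zero`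
  (`a₁ = 0` on a nonsingular Deuring-shaped model ⇒ `[z⁴][2] = a₃ ≠ 0`) — characteristic `2`,
  from the tree's `coeff_two/four_formalMul_two` (`FormalMulTwoLowOrderProofs`).
* `padicNorm_le_one_of_neronLattice_eq_smul_periodLattice_of_norm_j_le_one_two` — `‖q‖₂ ≤ 1` at
  an additive `2` with `‖j‖₂ ≤ 1`: with `v = v₂(Δ_min)`, `m = v₂(c₄)`, Kraus
  (`not_pow_dvd_c₄_minimalDiscriminantInt_two`) gives `v ≤ 23` and, when `v ≥ 16`, `m ≤ 7`,
  `v ≤ 3m`; three cases for the reduction of `V''`: ordinary (`J = 2`, `k < 2e`), supersingular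
  with `v < 16` (`J = 4`, `3k < 4e`), supersingular with `v ≥ 16` (vertex `j = 2`,
  `‖a₁''‖ = ‖π‖^{e(3m − v)/12}` because `‖a₁''‖¹² = ‖j‖₂ = 2^{v − 3m}`, and
  `k + e(3m − v)/12 < 2e ⇔ 3m < 24`) of the Newton-polygon enders `…_of_semistableTwist_sharp` /
  `_vertex` (`ManinConstantSemistableTwistSharpProofs`); `…_of_additive_two` adds the potentially
  multiplicative case (`ManinConstantPotMultiplicativeProofs`).
* `edixhoven_int_of_neronLattice_eq_smul_periodLattice_holds` and
  `ModularForms.edixhoven_optimalManinConstant_integral_holds` — THE FACT, by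
  `edixhoven_int_of_neronLattice_eq_smul_periodLattice_of_additive_two`
  (`ManinConstantLegendreTwistProofs`).

## References
* [EdixhovenManin1991] B. Edixhoven, *On the Manin constants of modular elliptic curves*,
  in: Arithmetic algebraic geometry (Texel, 1989), Progr. Math. 89 (1991), 25–39, Prop. 2.
* [AgasheRibetStein2006] A. Agashe, K. Ribet, W. Stein, *The Manin constant*, Pure Appl. Math.
  Q. 2 (2006), 617–636, Thm. 2.2.
* [SilvermanAEC2009] J. H. Silverman, *The Arithmetic of Elliptic Curves*, 2nd ed., GTM 106
  (2009): III.1 Table 3.1, IV.2.3, VII.5.4, VII.5.5, Exercises 3.7 and 7.1, Appendix A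
  Prop. 1.3 (the normal form `y² + a₁xy + a₃y = x³`, `c₄ = a₁(a₁³ − 24a₃)`, `Δ = a₃³(a₁³ − 27a₃)`).
* [Kraus1989] A. Kraus, *Quelques remarques à propos des invariants `c₄`, `c₆` et `Δ` d'une
  courbe elliptique*, Acta Arith. 54 (1989), 75–80.
-/

noncomputable section

open scoped Classical

namespace Literature.NumberTheory.EllipticCurves

open _root_.WeierstrassCurve Polynomial

/-! ### The Deuring (flex) normal form `y² + a₁xy + a₃y = x³` — pure algebra -/

section Deuring

variable {F : Type*} [Field F]

/-- `Ψ₃(x) = 3x⁴ + b₂x³ + 3b₄x² + 3b₆x + b₈`. [folklore] -/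
theorem eval_Ψ₃_eq (W : WeierstrassCurve F) (x : F) :
    W.Ψ₃.eval x = 3 * x ^ 4 + W.b₂ * x ^ 3 + 3 * W.b₄ * x ^ 2 + 3 * W.b₆ * x + W.b₈ := by
  simp only [WeierstrassCurve.Ψ₃, eval_add, eval_mul, eval_pow, eval_C, eval_X, eval_ofNat]

/-- **Bézout for `Ψ₃` and `Ψ₂²`:** `(48x² + 8b₂x + 32b₄ − b₂²)·Ψ₃(x) −
(36x³ + 9b₂x² + (42b₄ − b₂²)x + 27b₆ − b₂b₄)·Ψ₂²(x) = Δ` — a point cannot be both `2`- and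
`3`-torsion. [folklore] -/
theorem Ψ₃_bezout (W : WeierstrassCurve F) (x : F) :
    (48 * x ^ 2 + 8 * W.b₂ * x + 32 * W.b₄ - W.b₂ ^ 2) *
        (3 * x ^ 4 + W.b₂ * x ^ 3 + 3 * W.b₄ * x ^ 2 + 3 * W.b₆ * x + W.b₈) -
      (36 * x ^ 3 + 9 * W.b₂ * x ^ 2 + (42 * W.b₄ - W.b₂ ^ 2) * x + (27 * W.b₆ - W.b₂ * W.b₄)) *
        (4 * x ^ 3 + W.b₂ * x ^ 2 + 2 * W.b₄ * x + W.b₆) = W.Δ := by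
  simp only [WeierstrassCurve.Δ, WeierstrassCurve.b₂, WeierstrassCurve.b₄, WeierstrassCurve.b₆,
    WeierstrassCurve.b₈]
  ring

/-- `(2y + a₁x + a₃)² = Ψ₂²(x)` on the curve. [folklore] -/
theorem sq_ψ₂_eq (W : WeierstrassCurve F) {x y : F}
    (hE : y ^ 2 + W.a₁ * x * y + W.a₃ * y = x ^ 3 + W.a₂ * x ^ 2 + W.a₄ * x + W.a₆) :
    (W.a₃ + x * W.a₁ + 2 * y) ^ 2 = 4 * x ^ 3 + W.b₂ * x ^ 2 + 2 * W.b₄ * x + W.b₆ := by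
  simp only [WeierstrassCurve.b₂, WeierstrassCurve.b₄, WeierstrassCurve.b₆]
  linear_combination 4 * hE

/-- **The flex change of variables.** If `P = (x₀, y₀)` lies on `W` with `Ψ₃(x₀) = 0` (a point
of order `3`) and `D = a₃ + x₀a₁ + 2y₀ ≠ 0`, then with `N = a₄ + 2x₀a₂ − y₀a₁ + 3x₀²`,
`(1, x₀, N/D, y₀) • W = y² + (a₁ + 2N/D)xy + Dy = x³` (the tangent at the flex `P` becomes
`y = 0`): `a₄' = 0` identically, `a₆' = 0` by the equation, and `D²a₂' = (b₂ + 12x₀)·(eqn) +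
Ψ₃(x₀) = 0`. [cite: SilvermanAEC2009, Ex. 3.7, III.1 Table 3.1] -/
theorem flex_smul_eq (W : WeierstrassCurve F) {x₀ y₀ : F}
    (hE : y₀ ^ 2 + W.a₁ * x₀ * y₀ + W.a₃ * y₀ = x₀ ^ 3 + W.a₂ * x₀ ^ 2 + W.a₄ * x₀ + W.a₆)
    (hΨ : 3 * x₀ ^ 4 + W.b₂ * x₀ ^ 3 + 3 * W.b₄ * x₀ ^ 2 + 3 * W.b₆ * x₀ + W.b₈ = 0)
    (hD : W.a₃ + x₀ * W.a₁ + 2 * y₀ ≠ 0) :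
    (⟨1, x₀, (W.a₄ + 2 * x₀ * W.a₂ - y₀ * W.a₁ + 3 * x₀ ^ 2) / (W.a₃ + x₀ * W.a₁ + 2 * y₀), y₀⟩ :
        VariableChange F) • W =
      ⟨W.a₁ + 2 * ((W.a₄ + 2 * x₀ * W.a₂ - y₀ * W.a₁ + 3 * x₀ ^ 2) / (W.a₃ + x₀ * W.a₁ + 2 * y₀)),
        0, W.a₃ + x₀ * W.a₁ + 2 * y₀, 0, 0⟩ := by
  simp only [WeierstrassCurve.b₂, WeierstrassCurve.b₄, WeierstrassCurve.b₆,
    WeierstrassCurve.b₈] at hΨ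
  ext
  · rw [variableChange_a₁]
    simp only [inv_one, Units.val_one]
    ring
  · rw [variableChange_a₂]
    simp only [inv_one, Units.val_one, one_pow, one_mul]
    field_simp
    linear_combination (W.a₁ ^ 2 + 4 * W.a₂ + 12 * x₀) * hE + hΨ
  · rw [variableChange_a₃]
    simp only [inv_one, Units.val_one]
    ring
  · rw [variableChange_a₄]
    simp only [inv_one, Units.val_one, one_pow, one_mul]
    field_simp
    ring
  · rw [variableChange_a₆]
    simp only [inv_one, Units.val_one, one_pow, one_mul]
    linear_combination -hE

/-- The scalings of the Deuring form. [cite: SilvermanAEC2009, III.1 Table 3.1] -/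
theorem uScale_smul_deuringForm (A₁ A₃ : F) (u : Fˣ) :
    (⟨u, 0, 0, 0⟩ : VariableChange F) • (⟨A₁, 0, A₃, 0, 0⟩ : WeierstrassCurve F) =
      ⟨(u : F)⁻¹ * A₁, 0, (u : F)⁻¹ ^ 3 * A₃, 0, 0⟩ := by
  ext
  · rw [variableChange_a₁]; simp [Units.val_inv_eq_inv_val]
  · rw [variableChange_a₂]; simp
  · rw [variableChange_a₃]; simp [Units.val_inv_eq_inv_val]
  · rw [variableChange_a₄]; simp
  · rw [variableChange_a₆]; simp

end Deuring

/-! ### Ultrametric lemmas for the Deuring twist -/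

section Ultra

variable {F : Type*} [NormedField F] [IsUltrametricDist F]

/-- A root of `3x⁴ + Bx³ + Cx² + Dx + E` with `‖3‖ = 1` and integral `B, C, D, E` is integral.
[folklore] -/
theorem norm_le_one_of_Ψ₃_root {B C D E e : F} (h3 : ‖(3 : F)‖ = 1) (hB : ‖B‖ ≤ 1)
    (hC : ‖C‖ ≤ 1) (hD : ‖D‖ ≤ 1) (hEE : ‖E‖ ≤ 1)
    (he : 3 * e ^ 4 + B * e ^ 3 + C * e ^ 2 + D * e + E = 0) : ‖e‖ ≤ 1 := by
  by_contra hcon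
  rw [not_le] at hcon
  have he1 : 1 ≤ ‖e‖ := hcon.le
  have hpow : ∀ {m n : ℕ}, m ≤ n → ‖e‖ ^ m ≤ ‖e‖ ^ n := fun hmn ↦ pow_le_pow_right₀ he1 hmn
  have hlow : ‖B * e ^ 3 + C * e ^ 2 + D * e + E‖ ≤ ‖e‖ ^ 3 := by
    refine (IsUltrametricDist.norm_add_le_max _ _).trans (max_le ?_ (hEE.trans (one_le_pow₀ he1)))
    refine (IsUltrametricDist.norm_add_le_max _ _).trans (max_le ?_ ?_)
    · refine (IsUltrametricDist.norm_add_le_max _ _).trans (max_le ?_ ?_)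
      · rw [norm_mul, norm_pow]; exact mul_le_of_le_one_left (by positivity) hB
      · rw [norm_mul, norm_pow]
        exact (mul_le_of_le_one_left (by positivity) hC).trans (hpow (by norm_num))
    · rw [norm_mul]
      calc ‖D‖ * ‖e‖ ≤ 1 * ‖e‖ := by gcongr
        _ = ‖e‖ ^ 1 := by ring
        _ ≤ ‖e‖ ^ 3 := hpow (by norm_num)
  have hmain : ‖(3 : F) * e ^ 4‖ = ‖e‖ ^ 4 := by rw [norm_mul, norm_pow, h3, one_mul]
  have hlt : ‖(3 * e ^ 4 + (B * e ^ 3 + C * e ^ 2 + D * e + E)) - 3 * e ^ 4‖ < ‖(3 : F) * e ^ 4‖ := by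
    rw [add_sub_cancel_left, hmain]
    exact hlow.trans_lt (pow_lt_pow_right₀ hcon (by norm_num))
  have h := norm_eq_of_norm_sub_lt' hlt
  rw [show (3 : F) * e ^ 4 + (B * e ^ 3 + C * e ^ 2 + D * e + E) = 0 by rw [← he]; ring, norm_zero,
    hmain] at h
  exact absurd h.symm (pow_ne_zero 4 (one_pos.trans hcon).ne')

/-- A root of a monic quadratic `y² + By − C` with integral `B, C` is integral. [folklore] -/
theorem norm_le_one_of_monic_quadratic_root {B C y : F} (hB : ‖B‖ ≤ 1) (hC : ‖C‖ ≤ 1)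
    (hy : y ^ 2 + B * y = C) : ‖y‖ ≤ 1 := by
  by_contra hcon
  rw [not_le] at hcon
  have hlt : ‖(y ^ 2 + B * y) - y ^ 2‖ < ‖y ^ 2‖ := by
    rw [add_sub_cancel_left, norm_mul, norm_pow]
    calc ‖B‖ * ‖y‖ ≤ 1 * ‖y‖ := by gcongr
      _ < ‖y‖ ^ 2 := by rw [one_mul]; exact lt_self_pow₀ hcon (by norm_num)
  have h := norm_eq_of_norm_sub_lt' hlt
  rw [hy, norm_pow] at h
  have : ‖y‖ ^ 2 ≤ 1 := h ▸ hC
  exact absurd ((pow_le_one_iff_of_nonneg (norm_nonneg _) two_ne_zero).mp this) (not_le.mpr hcon)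

/-- **`‖t‖ ≤ 1` and `‖t − 27‖ = 1` when `‖j‖ ≤ 1`** for the Deuring form (`j = t(t − 24)³/(t − 27)`,
`t = A₁³/A₃`): if `‖t‖·‖t − 24‖³ ≤ ‖t − 27‖` with `‖3‖ = 1` (residue characteristic `≠ 3`), then
`‖t‖ ≤ 1` and `‖t − 27‖ = 1`. [cite: SilvermanAEC2009, VII.5.4, Appendix A Prop. 1.3] -/
theorem norm_le_one_and_norm_sub_eq_one_of_deuring {t : F} (h3 : ‖(3 : F)‖ = 1)
    (h : ‖t‖ * ‖t - 24‖ ^ 3 ≤ ‖t - 27‖) : ‖t‖ ≤ 1 ∧ ‖t - 27‖ = 1 := by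
  have h27 : ‖(27 : F)‖ = 1 := by rw [show (27 : F) = 3 ^ 3 by norm_num, norm_pow, h3, one_pow]
  have h24 : ‖(24 : F)‖ ≤ 1 := by simpa using IsUltrametricDist.norm_natCast_le_one F 24
  have ht1 : ‖t‖ ≤ 1 := by
    by_contra hcon
    rw [not_le] at hcon
    have e24 : ‖t - 24‖ = ‖t‖ :=
      norm_eq_of_norm_sub_lt' (by rw [sub_sub_cancel_left, norm_neg]; exact h24.trans_lt hcon)
    have e27 : ‖t - 27‖ = ‖t‖ :=
      norm_eq_of_norm_sub_lt' (by rw [sub_sub_cancel_left, norm_neg, h27]; exact hcon)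
    rw [e24, e27, ← pow_succ'] at h
    have : ‖t‖ ^ 1 < ‖t‖ ^ (3 + 1) := pow_lt_pow_right₀ hcon (by norm_num)
    rw [pow_one] at this
    linarith
  refine ⟨ht1,
    le_antisymm ((norm_sub_le_max_of_isUltrametricDist _ _).trans (max_le ht1 h27.le)) ?_⟩
  by_contra hcon
  rw [not_le] at hcon
  -- `‖t − 27‖ < 1`: then `‖t‖ = 1` and `‖t − 24‖ = ‖(t − 27) + 3‖ = 1`
  have et : ‖t‖ = 1 := by
    rw [← h27]; exact norm_eq_of_norm_sub_lt' (by rw [h27]; exact hcon)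
  have e24 : ‖t - 24‖ = 1 := by
    rw [show t - 24 = (t - 27) + 3 by ring, ← h3]
    rw [← h3] at hcon
    exact IsUltrametricDist.norm_add_eq_max_of_norm_ne_norm (ne_of_lt hcon) |>.trans
      (max_eq_right hcon.le)
  rw [et, e24, one_pow, one_mul] at h
  linarith

end Ultra


/-! ### The Deuring twist, I: the flex and the twelfth root over `ℚ̄_p` -/

section TwistA

open PowerSeries

set_option maxHeartbeats 2000000 in
/-- **Deuring data over `ℚ̄_p`** for a globally minimal `W'/ℚ` at a prime `p ≠ 3` with
`‖j‖_p ≤ 1`: a flex `(x₀, y₀)`, the shear `s₀`, the Deuring coefficients `A₁, D` of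
`(1, x₀, s₀, y₀) • W' = y² + A₁xy + Dy = x³`, and `u₀` with `u₀¹² = Δ(W')`, `‖A₁‖ ≤ ‖u₀‖`,
`‖u₀‖³ = ‖D‖`, so that `(u₀, x₀, s₀, y₀) • W' = (A₁/u₀, 0, D/u₀³, 0, 0)` is an INTEGRAL model with
discriminant `1`; all of `x₀, y₀, s₀` are integral. [cite: SilvermanAEC2009, VII.5.4, Appendix A Prop. 1.3, Ex. 3.7] -/
theorem exists_deuringData {p : ℕ} [hp : Fact p.Prime] (hp3 : p ≠ 3)
    (W' : WeierstrassCurve ℚ) [W'.IsElliptic] [W'.IsGloballyMinimal]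
    (hj : ‖((W'.j : ℚ) : ℚ_[p])‖ ≤ 1) :
    ∃ (x₀ y₀ s₀ A₁ D u₀ : PadicAlgCl p) (hu₀ : u₀ ≠ 0),
      IsIntegral ℚ_[p] x₀ ∧ IsIntegral ℚ_[p] y₀ ∧ IsIntegral ℚ_[p] u₀ ∧
      ‖x₀‖ ≤ 1 ∧ ‖y₀‖ ≤ 1 ∧ ‖s₀‖ ≤ 1 ∧ ‖A₁‖ ≤ ‖u₀‖ ∧ ‖u₀‖ ^ 3 = ‖D‖ ∧ D ≠ 0 ∧
      u₀ ^ 12 = algebraMap ℚ (PadicAlgCl p) W'.Δ ∧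
      D ^ 3 * (A₁ ^ 3 - 27 * D) = algebraMap ℚ (PadicAlgCl p) W'.Δ ∧
      s₀ * D = (W'.map (algebraMap ℚ (PadicAlgCl p))).a₄ +
        2 * x₀ * (W'.map (algebraMap ℚ (PadicAlgCl p))).a₂ -
        y₀ * (W'.map (algebraMap ℚ (PadicAlgCl p))).a₁ + 3 * x₀ ^ 2 ∧
      D = (W'.map (algebraMap ℚ (PadicAlgCl p))).a₃ +
        x₀ * (W'.map (algebraMap ℚ (PadicAlgCl p))).a₁ + 2 * y₀ ∧
      A₁ = (W'.map (algebraMap ℚ (PadicAlgCl p))).a₁ + 2 * s₀ ∧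
      (⟨Units.mk0 u₀ hu₀, x₀, s₀, y₀⟩ : VariableChange (PadicAlgCl p)) •
          W'.map (algebraMap ℚ (PadicAlgCl p)) = ⟨u₀⁻¹ * A₁, 0, u₀⁻¹ ^ 3 * D, 0, 0⟩ := by
  classical
  have hp1R : (1 : ℝ) < p := by exact_mod_cast hp.out.one_lt
  have hp0R : (0 : ℝ) < p := by positivity
  have hΔ0 : W'.Δ ≠ 0 := W'.isUnit_Δ.ne_zero
  set φA : ℚ →+* PadicAlgCl p := algebraMap ℚ (PadicAlgCl p) with hφA
  have hφA' : ∀ a : ℚ, φA a = algebraMap ℚ_[p] (PadicAlgCl p) (a : ℚ_[p]) := fun a ↦ by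
    rw [hφA, eq_ratCast, map_ratCast]
  have hnormA : ∀ a : ℚ, ‖φA a‖ = ‖(a : ℚ_[p])‖ := fun a ↦ by
    rw [hφA', PadicAlgCl.norm_extends]
  set W'A : WeierstrassCurve (PadicAlgCl p) := W'.map φA with hW'A
  /- the flex -/
  have h3A : (3 : PadicAlgCl p) ≠ 0 := three_ne_zero
  obtain ⟨x₀, hx₀⟩ : ∃ x, W'A.Ψ₃.IsRoot x := by
    refine IsAlgClosed.exists_root _ ?_
    rw [Polynomial.degree_eq_natDegree (W'A.Ψ₃_ne_zero h3A), W'A.natDegree_Ψ₃ h3A]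
    norm_num
  have hΨ : 3 * x₀ ^ 4 + W'A.b₂ * x₀ ^ 3 + 3 * W'A.b₄ * x₀ ^ 2 + 3 * W'A.b₆ * x₀ + W'A.b₈ = 0 := by
    rw [← eval_Ψ₃_eq]; exact hx₀
  obtain ⟨B, hB⟩ : ∃ B : PadicAlgCl p, B = W'A.a₁ * x₀ + W'A.a₃ := ⟨_, rfl⟩
  obtain ⟨C₀, hC₀⟩ : ∃ C₀ : PadicAlgCl p, C₀ = x₀ ^ 3 + W'A.a₂ * x₀ ^ 2 + W'A.a₄ * x₀ + W'A.a₆ :=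
    ⟨_, rfl⟩
  obtain ⟨δ, hδ⟩ := IsAlgClosed.exists_pow_nat_eq (B ^ 2 + 4 * C₀) two_pos
  obtain ⟨y₀, hy₀⟩ : ∃ y₀ : PadicAlgCl p, y₀ = (-B + δ) / 2 := ⟨_, rfl⟩
  have hE : y₀ ^ 2 + W'A.a₁ * x₀ * y₀ + W'A.a₃ * y₀ = x₀ ^ 3 + W'A.a₂ * x₀ ^ 2 + W'A.a₄ * x₀ + W'A.a₆ := by
    have h2 : (2 : PadicAlgCl p) ≠ 0 := two_ne_zero
    have e1 : y₀ ^ 2 + W'A.a₁ * x₀ * y₀ + W'A.a₃ * y₀ = y₀ ^ 2 + B * y₀ := by rw [hB]; ring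
    rw [← hC₀, e1, hy₀]
    field_simp
    linear_combination hδ
  obtain ⟨D, hDdef⟩ : ∃ D : PadicAlgCl p, D = W'A.a₃ + x₀ * W'A.a₁ + 2 * y₀ := ⟨_, rfl⟩
  have hΔA : W'A.Δ = φA W'.Δ := W'.map_Δ φA
  have hD0' : W'A.a₃ + x₀ * W'A.a₁ + 2 * y₀ ≠ 0 := by
    intro hD
    have hsq := sq_ψ₂_eq W'A hE
    rw [hD, zero_pow two_ne_zero] at hsq
    have hbz := Ψ₃_bezout W'A x₀
    rw [hΨ, ← hsq, mul_zero, mul_zero, sub_zero, hΔA] at hbz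
    exact hΔ0 ((map_eq_zero φA).mp hbz.symm)
  have hD0 : D ≠ 0 := by rw [hDdef]; exact hD0'
  obtain ⟨N, hNdef⟩ : ∃ N : PadicAlgCl p, N = W'A.a₄ + 2 * x₀ * W'A.a₂ - y₀ * W'A.a₁ + 3 * x₀ ^ 2 :=
    ⟨_, rfl⟩
  obtain ⟨s₀, hs₀⟩ : ∃ s₀ : PadicAlgCl p, s₀ = N / D := ⟨_, rfl⟩
  obtain ⟨A₁, hA₁⟩ : ∃ A₁ : PadicAlgCl p, A₁ = W'A.a₁ + 2 * s₀ := ⟨_, rfl⟩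
  have hflex : (⟨1, x₀, s₀, y₀⟩ : VariableChange (PadicAlgCl p)) • W'A = ⟨A₁, 0, D, 0, 0⟩ := by
    have h := flex_smul_eq W'A hE hΨ hD0'
    rw [← hDdef, ← hNdef, ← hs₀, ← hA₁] at h
    exact h
  have hΔD : D ^ 3 * (A₁ ^ 3 - 27 * D) = φA W'.Δ := by
    rw [← threeTorsionForm_Δ, ← hflex, variableChange_Δ]
    simp only [inv_one, Units.val_one, one_pow, one_mul]
    exact hΔA
  have hjD : φA W'.j * (D ^ 3 * (A₁ ^ 3 - 27 * D)) = (A₁ * (A₁ ^ 3 - 24 * D)) ^ 3 := by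
    have h := j_mul_Δ_eq_c₄_pow ((⟨1, x₀, s₀, y₀⟩ : VariableChange (PadicAlgCl p)) • W'A)
    have hjv : ((⟨1, x₀, s₀, y₀⟩ : VariableChange (PadicAlgCl p)) • W'A).j = φA W'.j := by
      rw [WeierstrassCurve.variableChange_j]; exact W'.map_j φA
    have hΔv : ((⟨1, x₀, s₀, y₀⟩ : VariableChange (PadicAlgCl p)) • W'A).Δ = D ^ 3 * (A₁ ^ 3 - 27 * D) := by
      rw [hflex]; exact threeTorsionForm_Δ A₁ D
    have hc₄v : ((⟨1, x₀, s₀, y₀⟩ : VariableChange (PadicAlgCl p)) • W'A).c₄ = A₁ * (A₁ ^ 3 - 24 * D) := by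
      rw [hflex]; exact threeTorsionForm_c₄ A₁ D
    rwa [hjv, hΔv, hc₄v] at h
  /- `‖t‖ ≤ 1`, `‖t − 27‖ = 1` -/
  have hp3A : ‖(3 : PadicAlgCl p)‖ = 1 := by
    rw [← map_ofNat (algebraMap ℚ_[p] (PadicAlgCl p)) 3]
    change ‖((3 : ℚ_[p]) : PadicAlgCl p)‖ = 1
    rw [PadicAlgCl.norm_extends, show (3 : ℚ_[p]) = ((3 : ℕ) : ℚ_[p]) by norm_num,
      Padic.norm_natCast_eq_one_iff]
    exact (Nat.coprime_primes hp.out Nat.prime_three).mpr hp3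
  obtain ⟨tt, htt⟩ : ∃ tt : PadicAlgCl p, tt = A₁ ^ 3 / D := ⟨_, rfl⟩
  have htt' : A₁ ^ 3 = tt * D := by rw [htt, div_mul_cancel₀ _ hD0]
  have hjt : φA W'.j * (tt - 27) = tt * (tt - 24) ^ 3 := by
    have hD4 : D ^ 4 ≠ 0 := pow_ne_zero 4 hD0
    apply mul_left_cancel₀ hD4
    have e1 : D ^ 4 * (φA W'.j * (tt - 27)) = φA W'.j * (D ^ 3 * (A₁ ^ 3 - 27 * D)) := by
      rw [htt']; ring
    have e2 : D ^ 4 * (tt * (tt - 24) ^ 3) = (A₁ * (A₁ ^ 3 - 24 * D)) ^ 3 := by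
      have : (A₁ * (A₁ ^ 3 - 24 * D)) ^ 3 = A₁ ^ 3 * (A₁ ^ 3 - 24 * D) ^ 3 := by ring
      rw [this, htt']; ring
    rw [e1, e2, hjD]
  have htnorm : ‖tt‖ ≤ 1 ∧ ‖tt - 27‖ = 1 := by
    refine norm_le_one_and_norm_sub_eq_one_of_deuring hp3A ?_
    have hn : ‖φA W'.j * (tt - 27)‖ = ‖tt * (tt - 24) ^ 3‖ := by rw [hjt]
    rw [norm_mul, norm_mul, norm_pow, hnormA] at hn
    rw [← hn]
    exact mul_le_of_le_one_left (norm_nonneg _) hj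
  obtain ⟨ht1, ht27⟩ := htnorm
  obtain ⟨u₀, hu₀⟩ := IsAlgClosed.exists_pow_nat_eq (φA W'.Δ) (by norm_num : 0 < 12)
  have hu₀0 : u₀ ≠ 0 := by
    intro h; rw [h, zero_pow (by norm_num)] at hu₀
    exact hΔ0 ((map_eq_zero φA).mp hu₀.symm)
  have hnu₀D : ‖u₀‖ ^ 3 = ‖D‖ := by
    have h12 : ‖u₀‖ ^ 12 = ‖D‖ ^ 4 := by
      calc ‖u₀‖ ^ 12 = ‖u₀ ^ 12‖ := (norm_pow _ _).symm
        _ = ‖D ^ 3 * ((tt - 27) * D)‖ := by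
            rw [hu₀, ← hΔD, show A₁ ^ 3 - 27 * D = (tt - 27) * D by rw [sub_mul, ← htt']]
        _ = ‖D‖ ^ 3 * (‖tt - 27‖ * ‖D‖) := by rw [norm_mul, norm_pow, norm_mul]
        _ = ‖D‖ ^ 4 := by rw [ht27]; ring
    rw [show (12 : ℕ) = 3 * 4 from rfl, pow_mul] at h12
    exact (pow_left_inj₀ (by positivity) (norm_nonneg _) four_ne_zero).mp h12
  have hnA₁ : ‖A₁‖ ≤ ‖u₀‖ := by
    have h3 : ‖A₁‖ ^ 3 ≤ ‖u₀‖ ^ 3 := by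
      rw [← norm_pow, htt', norm_mul, hnu₀D]
      exact mul_le_of_le_one_left (norm_nonneg _) ht1
    exact le_of_pow_le_pow_left₀ three_ne_zero (norm_nonneg _) h3
  have hnu₀ : ‖u₀‖ ≤ 1 := by
    have : ‖u₀‖ ^ 12 ≤ 1 := by
      rw [← norm_pow, hu₀, hnormA]; exact Padic.norm_int_le_one _ |>.trans_eq' (by
        rw [← cast_minimalDiscriminantInt, Rat.cast_intCast])
    exact (pow_le_one_iff_of_nonneg (norm_nonneg _) (by norm_num)).mp this
  /- integrality of the coefficients and of `x₀, y₀` -/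
  have hintA : ∀ x : ℤ, ‖φA (x : ℚ)‖ ≤ 1 := fun x ↦ by
    rw [hnormA, Rat.cast_intCast]; exact Padic.norm_int_le_one x
  have hiW := map_integralModelInt W'
  have haI : ∀ f : WeierstrassCurve ℤ → ℤ, ∀ g : WeierstrassCurve ℚ → ℚ,
      (∀ (V : WeierstrassCurve ℤ), g (V.map (Int.castRingHom ℚ)) = (f V : ℚ)) →
      g W' = (f (integralModelInt W') : ℚ) := fun f g hfg ↦ by rw [← hfg, hiW]
  have ha₁ : W'.a₁ = ((integralModelInt W').a₁ : ℚ) := haI (·.a₁) (·.a₁) (fun V ↦ by simp [WeierstrassCurve.map])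
  have ha₂ : W'.a₂ = ((integralModelInt W').a₂ : ℚ) := haI (·.a₂) (·.a₂) (fun V ↦ by simp [WeierstrassCurve.map])
  have ha₃ : W'.a₃ = ((integralModelInt W').a₃ : ℚ) := haI (·.a₃) (·.a₃) (fun V ↦ by simp [WeierstrassCurve.map])
  have ha₄ : W'.a₄ = ((integralModelInt W').a₄ : ℚ) := haI (·.a₄) (·.a₄) (fun V ↦ by simp [WeierstrassCurve.map])
  have ha₆ : W'.a₆ = ((integralModelInt W').a₆ : ℚ) := haI (·.a₆) (·.a₆) (fun V ↦ by simp [WeierstrassCurve.map])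
  have hb₂ : W'.b₂ = ((integralModelInt W').b₂ : ℚ) := haI (·.b₂) (·.b₂) (fun V ↦ by
    rw [WeierstrassCurve.map_b₂, eq_intCast])
  have hb₄ : W'.b₄ = ((integralModelInt W').b₄ : ℚ) := haI (·.b₄) (·.b₄) (fun V ↦ by
    rw [WeierstrassCurve.map_b₄, eq_intCast])
  have hb₆ : W'.b₆ = ((integralModelInt W').b₆ : ℚ) := haI (·.b₆) (·.b₆) (fun V ↦ by
    rw [WeierstrassCurve.map_b₆, eq_intCast])
  have hb₈ : W'.b₈ = ((integralModelInt W').b₈ : ℚ) := haI (·.b₈) (·.b₈) (fun V ↦ by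
    rw [WeierstrassCurve.map_b₈, eq_intCast])
  have hna₁ : ‖W'A.a₁‖ ≤ 1 := by change ‖φA W'.a₁‖ ≤ 1; rw [ha₁]; exact hintA _
  have hna₂ : ‖W'A.a₂‖ ≤ 1 := by change ‖φA W'.a₂‖ ≤ 1; rw [ha₂]; exact hintA _
  have hna₃ : ‖W'A.a₃‖ ≤ 1 := by change ‖φA W'.a₃‖ ≤ 1; rw [ha₃]; exact hintA _
  have hna₄ : ‖W'A.a₄‖ ≤ 1 := by change ‖φA W'.a₄‖ ≤ 1; rw [ha₄]; exact hintA _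
  have hna₆ : ‖W'A.a₆‖ ≤ 1 := by change ‖φA W'.a₆‖ ≤ 1; rw [ha₆]; exact hintA _
  have hnb₂ : ‖W'A.b₂‖ ≤ 1 := by rw [hW'A, WeierstrassCurve.map_b₂, hb₂]; exact hintA _
  have hnb₄ : ‖W'A.b₄‖ ≤ 1 := by rw [hW'A, WeierstrassCurve.map_b₄, hb₄]; exact hintA _
  have hnb₆ : ‖W'A.b₆‖ ≤ 1 := by rw [hW'A, WeierstrassCurve.map_b₆, hb₆]; exact hintA _
  have hnb₈ : ‖W'A.b₈‖ ≤ 1 := by rw [hW'A, WeierstrassCurve.map_b₈, hb₈]; exact hintA _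
  have hmul1 : ∀ {a b : PadicAlgCl p}, ‖a‖ ≤ 1 → ‖b‖ ≤ 1 → ‖a * b‖ ≤ 1 := fun ha hb ↦ by
    rw [norm_mul]; exact mul_le_one₀ ha (norm_nonneg _) hb
  have hadd1 : ∀ {a b : PadicAlgCl p}, ‖a‖ ≤ 1 → ‖b‖ ≤ 1 → ‖a + b‖ ≤ 1 := fun ha hb ↦
    (IsUltrametricDist.norm_add_le_max _ _).trans (max_le ha hb)
  have h31 : ‖(3 : PadicAlgCl p)‖ ≤ 1 := hp3A.le
  have hnx₀ : ‖x₀‖ ≤ 1 :=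
    norm_le_one_of_Ψ₃_root hp3A hnb₂ (hmul1 h31 hnb₄) (hmul1 h31 hnb₆) hnb₈ hΨ
  have hnB : ‖B‖ ≤ 1 := by rw [hB]; exact hadd1 (hmul1 hna₁ hnx₀) hna₃
  have hpx : ∀ n : ℕ, ‖x₀ ^ n‖ ≤ 1 := fun n ↦ by rw [norm_pow]; exact pow_le_one₀ (norm_nonneg _) hnx₀
  have hnC₀ : ‖C₀‖ ≤ 1 := by
    rw [hC₀]; exact hadd1 (hadd1 (hadd1 (hpx 3) (hmul1 hna₂ (hpx 2))) (hmul1 hna₄ hnx₀)) hna₆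
  have hny₀ : ‖y₀‖ ≤ 1 := by
    refine norm_le_one_of_monic_quadratic_root hnB hnC₀ ?_
    rw [hB, hC₀]; linear_combination hE
  -- integrality over `ℚ_p`
  have hQi : ∀ a : ℚ, IsIntegral ℚ_[p] (φA a) := fun a ↦ by rw [hφA']; exact isIntegral_algebraMap
  have hx₀i : IsIntegral ℚ_[p] x₀ := by
    refine IsAlgebraic.isIntegral ⟨Polynomial.C 3 * Polynomial.X ^ 4 +
      Polynomial.C ((W'.b₂ : ℚ) : ℚ_[p]) * Polynomial.X ^ 3 +
      Polynomial.C ((3 * W'.b₄ : ℚ) : ℚ_[p]) * Polynomial.X ^ 2 +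
      Polynomial.C ((3 * W'.b₆ : ℚ) : ℚ_[p]) * Polynomial.X + Polynomial.C ((W'.b₈ : ℚ) : ℚ_[p]),
      fun h0 ↦ ?_, ?_⟩
    · have := congrArg (Polynomial.coeff · 4) h0
      simp only [Polynomial.coeff_add, Polynomial.coeff_C_mul, Polynomial.coeff_X_pow,
        Polynomial.coeff_C, Polynomial.coeff_X, Polynomial.coeff_zero] at this
      norm_num at this
    · simp only [map_add, map_mul, Polynomial.aeval_C, Polynomial.aeval_X_pow, Polynomial.aeval_X,
        map_ofNat]
      rw [← hφA', ← hφA', ← hφA', ← hφA', map_mul, map_mul, map_ofNat]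
      have hΨ' := hΨ
      rw [hW'A, WeierstrassCurve.map_b₂, WeierstrassCurve.map_b₄, WeierstrassCurve.map_b₆,
        WeierstrassCurve.map_b₈] at hΨ'
      linear_combination hΨ'
  have hBi : IsIntegral ℚ_[p] B := by rw [hB]; exact ((hQi _).mul hx₀i).add (hQi _)
  have hC₀i : IsIntegral ℚ_[p] C₀ := by
    rw [hC₀]; exact (((hx₀i.pow 3).add ((hQi _).mul (hx₀i.pow 2))).add ((hQi _).mul hx₀i)).add (hQi _)
  have h4i : IsIntegral ℚ_[p] (4 : PadicAlgCl p) := by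
    have h := isIntegral_algebraMap (R := ℚ_[p]) (A := PadicAlgCl p) (x := 4)
    rwa [map_ofNat] at h
  have h2i : IsIntegral ℚ_[p] ((2 : PadicAlgCl p)⁻¹) := by
    have h := isIntegral_algebraMap (R := ℚ_[p]) (A := PadicAlgCl p) (x := 2⁻¹)
    rwa [map_inv₀, map_ofNat] at h
  have hδi : IsIntegral ℚ_[p] δ :=
    IsIntegral.of_pow two_pos (by rw [hδ]; exact (hBi.pow 2).add (h4i.mul hC₀i))
  have hy₀i : IsIntegral ℚ_[p] y₀ := by
    rw [hy₀, div_eq_mul_inv]; exact (hBi.neg.add hδi).mul h2i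
  have hu₀i : IsIntegral ℚ_[p] u₀ := IsIntegral.of_pow (by norm_num : 0 < 12) (by rw [hu₀]; exact hQi _)
  /- the integral Deuring model `(u₀, x₀, s₀, y₀) • W'A` and `s₀ ∈ O` -/
  have hVA : (⟨Units.mk0 u₀ hu₀0, x₀, s₀, y₀⟩ : VariableChange (PadicAlgCl p)) • W'A =
      ⟨u₀⁻¹ * A₁, 0, u₀⁻¹ ^ 3 * D, 0, 0⟩ := by
    have hmul : (⟨Units.mk0 u₀ hu₀0, x₀, s₀, y₀⟩ : VariableChange (PadicAlgCl p)) =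
        ⟨Units.mk0 u₀ hu₀0, 0, 0, 0⟩ * ⟨1, x₀, s₀, y₀⟩ := by
      rw [VariableChange.mul_def]
      simp only [Units.val_one, one_pow, mul_one, zero_mul, zero_add, mul_zero, add_zero]
    rw [hmul, mul_smul, hflex, uScale_smul_deuringForm, Units.val_mk0]
  have hsA : ‖s₀‖ ≤ 1 := by
    have h := norm_rst_le_one_of_variableChange_eq hVA (by rw [Units.val_mk0]; exact hnu₀)
      ⟨hna₁, hna₂, hna₃, hna₄, hna₆⟩ ⟨?_, by simp, ?_, by simp, by simp⟩
    · exact h.2.1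
    · rw [norm_mul, norm_inv]
      calc ‖u₀‖⁻¹ * ‖A₁‖ ≤ ‖u₀‖⁻¹ * ‖u₀‖ := by gcongr
        _ = 1 := inv_mul_cancel₀ (norm_pos_iff.mpr hu₀0).ne'
    · rw [norm_mul, norm_pow, norm_inv, ← hnu₀D, inv_pow,
        inv_mul_cancel₀ (pow_ne_zero 3 (norm_pos_iff.mpr hu₀0).ne')]
  refine ⟨x₀, y₀, s₀, A₁, D, u₀, hu₀0, hx₀i, hy₀i, hu₀i, hnx₀, hny₀, hsA, hnA₁, hnu₀D, hD0, hu₀, hΔD,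
    ?_, hDdef, hA₁, hVA⟩
  rw [hs₀, div_mul_cancel₀ _ hD0, hNdef]

end TwistA


/-! ### The Deuring twist, II: the field `K = ℚ_p(x₀, y₀, u₀, p^{1/12})` and the `O`-model -/

section TwistB

open scoped IntermediateField
open Literature.NumberTheory.GaloisRepresentations IsLocalRing PowerSeries

set_option maxHeartbeats 4000000 in
/-- **The Deuring twist at a prime `p ≠ 3` with `‖j‖_p ≤ 1`** (see `exists_deuringData`): over
`K = ℚ_p(x₀, y₀, u₀, p^{1/12})` (so `12 ∣ e`), with `O = 𝒪_K`, a uniformiser `π`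
(`‖π‖ᵉ = p⁻¹`) and the unit part `w` of `u₀ = wπᵏ`, the `O`-curve
`V'' = (wA₁/u₀, 0, w³D/u₀³, 0, 0)` — Deuring shape, `Δ(V'') = w¹² ∈ O^×` — satisfies
`V'' ⊗ K = (πᵏ, x₀, s₀, y₀) • (W' ⊗ K)` with `x₀, s₀, y₀ ∈ O` and `12k = e·v_p(Δ_min)`.
[cite: SilvermanAEC2009, VII.5.4, VII.5.5, Appendix A Prop. 1.3] -/
theorem exists_deuringTwist_of_norm_j_le_one {p : ℕ} [hp : Fact p.Prime] (hp3 : p ≠ 3)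
    (W' : WeierstrassCurve ℚ) [W'.IsElliptic] [W'.IsGloballyMinimal]
    (hj : ‖((W'.j : ℚ) : ℚ_[p])‖ ≤ 1) {v : ℕ} (hv : ‖((W'.Δ : ℚ) : ℚ_[p])‖ = ((p : ℝ)⁻¹) ^ v) :
    ∃ (K : IntermediateField ℚ_[p] (PadicAlgCl p)) (_ : FiniteDimensional ℚ_[p] K) (πu : Kˣ)
      (e k : ℕ) (r s t : padicCoeffRing K) (V'' : WeierstrassCurve (padicCoeffRing K)),
      ‖((πu : K) : PadicAlgCl p)‖ ^ e = (p : ℝ)⁻¹ ∧ 0 < e ∧ 12 ∣ e ∧ 12 * k = v * e ∧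
      V''.map (algebraMap (padicCoeffRing K) K) =
        (⟨πu ^ k, (r : K), (s : K), (t : K)⟩ : VariableChange K) • W'.map (algebraMap ℚ K) ∧
      IsUnit V''.Δ ∧ V''.a₂ = 0 ∧ V''.a₄ = 0 ∧ V''.a₆ = 0 := by
  classical
  have hp1R : (1 : ℝ) < p := by exact_mod_cast hp.out.one_lt
  have hp0R : (0 : ℝ) < p := by positivity
  obtain ⟨x₀, y₀, s₀, A₁, D, u₀, hu₀0, hx₀i, hy₀i, hu₀i, hnx₀, hny₀, hns₀, hnA₁, hnu₀D, hD0, hu₀, hΔD,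
    hsD, hDdef, hA₁def, hVA⟩ := exists_deuringData hp3 W' hj
  set φA : ℚ →+* PadicAlgCl p := algebraMap ℚ (PadicAlgCl p) with hφA
  set φ : ℚ →+* ℚ_[p] := algebraMap ℚ ℚ_[p] with hφ
  have hφA' : ∀ a : ℚ, φA a = algebraMap ℚ_[p] (PadicAlgCl p) (a : ℚ_[p]) := fun a ↦ by
    rw [hφA, eq_ratCast, map_ratCast]
  have hnormA : ∀ a : ℚ, ‖φA a‖ = ‖(a : ℚ_[p])‖ := fun a ↦ by rw [hφA', PadicAlgCl.norm_extends]
  set W'A : WeierstrassCurve (PadicAlgCl p) := W'.map φA with hW'A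
  have hnu₀12 : ‖u₀‖ ^ 12 = ((p : ℝ)⁻¹) ^ v := by rw [← norm_pow, hu₀, hnormA, hv]
  have hnu₀ : ‖u₀‖ ≤ 1 := by
    have : ‖u₀‖ ^ 12 ≤ 1 := by
      rw [hnu₀12]; exact pow_le_one₀ (by positivity) (inv_le_one_of_one_le₀ hp1R.le)
    exact (pow_le_one_iff_of_nonneg (norm_nonneg _) (by norm_num)).mp this
  -- `p^{1/12}`
  obtain ⟨ϖ₀, hϖ₀⟩ := IsAlgClosed.exists_pow_nat_eq ((p : ℕ) : PadicAlgCl p) (by norm_num : 0 < 12)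
  have hpA : ‖((p : ℕ) : PadicAlgCl p)‖ = (p : ℝ)⁻¹ := by
    rw [← map_natCast (algebraMap ℚ_[p] (PadicAlgCl p)) p]
    change ‖((p : ℚ_[p]) : PadicAlgCl p)‖ = (p : ℝ)⁻¹
    rw [PadicAlgCl.norm_extends, Padic.norm_p]
  have hnϖ₀ : ‖ϖ₀‖ ^ 12 = (p : ℝ)⁻¹ := by rw [← norm_pow, hϖ₀, hpA]
  have hϖ₀i : IsIntegral ℚ_[p] ϖ₀ := IsIntegral.of_pow (by norm_num : 0 < 12) (by
    rw [hϖ₀, ← map_natCast (algebraMap ℚ_[p] (PadicAlgCl p)) p]; exact isIntegral_algebraMap)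
  /- the field `K` -/
  set Sgen : Set (PadicAlgCl p) := {x₀, y₀, u₀, ϖ₀} with hSgen
  set K : IntermediateField ℚ_[p] (PadicAlgCl p) := IntermediateField.adjoin ℚ_[p] Sgen with hKdef
  haveI hKfd : FiniteDimensional ℚ_[p] K := by
    refine IntermediateField.finiteDimensional_adjoin fun x hx ↦ ?_
    rcases hx with rfl | rfl | rfl | rfl
    exacts [hx₀i, hy₀i, hu₀i, hϖ₀i]
  set φK : ℚ_[p] →+* K := algebraMap ℚ_[p] K with hφK
  set φQ : ℚ →+* K := algebraMap ℚ K with hφQ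
  set jA : K →+* PadicAlgCl p := algebraMap K (PadicAlgCl p) with hjA
  have hjA' : ∀ x : K, jA x = (x : PadicAlgCl p) := fun x ↦ rfl
  have hjAinj : Function.Injective jA := jA.injective
  have hcomp : φK.comp φ = φQ := RingHom.ext fun x ↦ by
    rw [eq_ratCast (φK.comp φ) x, eq_ratCast φQ x]
  have hφQ' : ∀ x : ℚ, φQ x = φK (x : ℚ_[p]) := fun x ↦ by
    rw [← hcomp, RingHom.comp_apply, hφ, eq_ratCast]
  have hQA : ∀ a : ℚ, ((φQ a : K) : PadicAlgCl p) = φA a := fun a ↦ by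
    rw [hφQ', hφK, IntermediateField.coe_algebraMap_apply, hφA']
  have hnormQ : ∀ x : ℚ, ‖((φQ x : K) : PadicAlgCl p)‖ = ‖(x : ℚ_[p])‖ := fun x ↦ by
    rw [hQA, hnormA]
  have hjAφQ : jA.comp φQ = φA := RingHom.ext fun a ↦ by rw [RingHom.comp_apply, hjA', hQA]
  set W'K : WeierstrassCurve K := W'.map φQ with hW'K
  have hW'KA : W'K.map jA = W'A := by rw [hW'K, WeierstrassCurve.map_map, hjAφQ]
  have hmem : ∀ x ∈ Sgen, x ∈ K := fun x hx ↦ IntermediateField.subset_adjoin ℚ_[p] Sgen hx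
  set x₀K : K := ⟨x₀, hmem x₀ (by simp [hSgen])⟩ with hx₀K
  set y₀K : K := ⟨y₀, hmem y₀ (by simp [hSgen])⟩ with hy₀K
  set uK : K := ⟨u₀, hmem u₀ (by simp [hSgen])⟩ with huK
  set ϖ₀K : K := ⟨ϖ₀, hmem ϖ₀ (by simp [hSgen])⟩ with hϖ₀K
  have huK0 : uK ≠ 0 := fun h ↦ hu₀0 (congrArg Subtype.val h)
  -- `K`-versions of `D, s₀, A₁`
  set DK : K := W'K.a₃ + x₀K * W'K.a₁ + 2 * y₀K with hDK
  set NK : K := W'K.a₄ + 2 * x₀K * W'K.a₂ - y₀K * W'K.a₁ + 3 * x₀K ^ 2 with hNK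
  set sK : K := NK / DK with hsK
  set A₁K : K := W'K.a₁ + 2 * sK with hA₁K
  have hK2 : ((2 : K) : PadicAlgCl p) = 2 := by rw [← map_ofNat φQ 2, hQA, map_ofNat]
  have hK3 : ((3 : K) : PadicAlgCl p) = 3 := by rw [← map_ofNat φQ 3, hQA, map_ofNat]
  have hWa₁ : ((W'K.a₁ : K) : PadicAlgCl p) = W'A.a₁ := hQA _
  have hWa₂ : ((W'K.a₂ : K) : PadicAlgCl p) = W'A.a₂ := hQA _
  have hWa₃ : ((W'K.a₃ : K) : PadicAlgCl p) = W'A.a₃ := hQA _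
  have hWa₄ : ((W'K.a₄ : K) : PadicAlgCl p) = W'A.a₄ := hQA _
  have hDKA : ((DK : K) : PadicAlgCl p) = D := by
    rw [hDK, hDdef]
    have : ((W'K.a₃ + x₀K * W'K.a₁ + 2 * y₀K : K) : PadicAlgCl p) =
        ((W'K.a₃ : K) : PadicAlgCl p) + ((x₀K : K) : PadicAlgCl p) * ((W'K.a₁ : K) : PadicAlgCl p) +
          ((2 : K) : PadicAlgCl p) * ((y₀K : K) : PadicAlgCl p) := by push_cast; ring
    rw [this, hWa₃, hWa₁, hK2]
  have hNKA : ((NK : K) : PadicAlgCl p) = s₀ * D := by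
    rw [hNK, hsD]
    have : ((W'K.a₄ + 2 * x₀K * W'K.a₂ - y₀K * W'K.a₁ + 3 * x₀K ^ 2 : K) : PadicAlgCl p) =
        ((W'K.a₄ : K) : PadicAlgCl p) + ((2 : K) : PadicAlgCl p) * ((x₀K : K) : PadicAlgCl p) *
          ((W'K.a₂ : K) : PadicAlgCl p) - ((y₀K : K) : PadicAlgCl p) * ((W'K.a₁ : K) : PadicAlgCl p) +
          ((3 : K) : PadicAlgCl p) * ((x₀K : K) : PadicAlgCl p) ^ 2 := by push_cast; ring
    rw [this, hWa₄, hWa₂, hWa₁, hK2, hK3]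
  have hsKA : ((sK : K) : PadicAlgCl p) = s₀ := by
    rw [hsK]
    have : ((NK / DK : K) : PadicAlgCl p) = ((NK : K) : PadicAlgCl p) / ((DK : K) : PadicAlgCl p) := by
      push_cast; ring
    rw [this, hNKA, hDKA, mul_div_cancel_right₀ _ hD0]
  have hA₁KA : ((A₁K : K) : PadicAlgCl p) = A₁ := by
    rw [hA₁K, hA₁def]
    have : ((W'K.a₁ + 2 * sK : K) : PadicAlgCl p) =
        ((W'K.a₁ : K) : PadicAlgCl p) + ((2 : K) : PadicAlgCl p) * ((sK : K) : PadicAlgCl p) := by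
      push_cast; ring
    rw [this, hWa₁, hK2, hsKA]
  /- `O`, a uniformiser, `e` with `12 ∣ e`; `u₀ = wϖᵏ`, `12k = ve` -/
  letI hOloc : IsLocalRing (padicCoeffRing K) := isLocalRing_padicCoeffRing K
  haveI hOdvr : IsDiscreteValuationRing (padicCoeffRing K) :=
    isDiscreteValuationRing_padicCoeffRing K
  obtain ⟨ϖ, hϖ⟩ := IsDiscreteValuationRing.exists_irreducible (padicCoeffRing K)
  have hϖ0 : ((ϖ : padicCoeffRing K) : K) ≠ 0 := fun h ↦ hϖ.ne_zero (Subtype.ext h)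
  have hϖA0 : (((ϖ : padicCoeffRing K) : K) : PadicAlgCl p) ≠ 0 := fun h ↦ hϖ0 (by exact_mod_cast h)
  have hϖlt : ‖(((ϖ : padicCoeffRing K) : K) : PadicAlgCl p)‖ < 1 :=
    (mem_nonunits_padicCoeffRing_iff K ϖ).mp (mem_nonunits_iff.mpr hϖ.not_isUnit)
  have hϖpos : 0 < ‖(((ϖ : padicCoeffRing K) : K) : PadicAlgCl p)‖ := norm_pos_iff.mpr hϖA0
  have hpO0 : ((p : ℕ) : padicCoeffRing K) ≠ 0 := by
    intro h
    have h1 : ‖((((p : ℕ) : padicCoeffRing K) : K) : PadicAlgCl p)‖ = 0 := by rw [h]; simp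
    push_cast at h1
    rw [hpA] at h1
    exact (inv_ne_zero hp0R.ne') h1
  obtain ⟨e, vu, hpe⟩ := IsDiscreteValuationRing.eq_unit_mul_pow_irreducible hpO0 hϖ
  have hπe : ‖(((ϖ : padicCoeffRing K) : K) : PadicAlgCl p)‖ ^ e = (p : ℝ)⁻¹ := by
    have h : ‖((((p : ℕ) : padicCoeffRing K) : K) : PadicAlgCl p)‖ =
        ‖(((vu * ϖ ^ e : padicCoeffRing K) : K) : PadicAlgCl p)‖ := by rw [hpe]
    push_cast at h
    rw [norm_mul, norm_pow, (isUnit_padicCoeffRing_iff K _).mp vu.isUnit, one_mul, hpA] at h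
    exact h.symm
  have he0 : 0 < e := by
    rcases Nat.eq_zero_or_pos e with h | h
    · rw [h, pow_zero] at hπe
      exact absurd hπe (ne_of_gt (inv_lt_one_of_one_lt₀ hp1R))
    · exact h
  have h12e : 12 ∣ e := by
    have hnϖ₀le : ‖ϖ₀‖ ≤ 1 := by
      have : ‖ϖ₀‖ ^ 12 ≤ 1 := by rw [hnϖ₀]; exact inv_le_one_of_one_le₀ hp1R.le
      exact (pow_le_one_iff_of_nonneg (norm_nonneg _) (by norm_num)).mp this
    have hϖ₀0 : ϖ₀ ≠ 0 := by
      intro h; rw [h, zero_pow (by norm_num)] at hϖ₀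
      exact (Nat.cast_ne_zero.mpr hp.out.ne_zero : ((p : ℕ) : PadicAlgCl p) ≠ 0) hϖ₀.symm
    set ϖ₀O : padicCoeffRing K := ⟨ϖ₀K, (mem_padicCoeffRing_iff K _).mpr hnϖ₀le⟩ with hϖ₀O
    have hϖ₀O0 : ϖ₀O ≠ 0 := fun h ↦
      hϖ₀0 (congrArg (fun z : padicCoeffRing K ↦ ((z : K) : PadicAlgCl p)) h)
    obtain ⟨m, w', hm⟩ := IsDiscreteValuationRing.eq_unit_mul_pow_irreducible hϖ₀O0 hϖ
    have h : ‖(((ϖ₀O : padicCoeffRing K) : K) : PadicAlgCl p)‖ ^ 12 =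
        ‖((((w' * ϖ ^ m : padicCoeffRing K)) : K) : PadicAlgCl p)‖ ^ 12 := by rw [hm]
    change ‖ϖ₀‖ ^ 12 = _ at h
    push_cast at h
    rw [hnϖ₀, norm_mul, norm_pow, (isUnit_padicCoeffRing_iff K _).mp w'.isUnit, one_mul, ← pow_mul,
      ← hπe] at h
    have h' := pow_right_injective₀ hϖpos hϖlt.ne h
    exact ⟨m, by rw [h', mul_comm]⟩
  set uO : padicCoeffRing K := ⟨uK, (mem_padicCoeffRing_iff K _).mpr hnu₀⟩ with huO
  have huO0 : uO ≠ 0 := fun h ↦ huK0 (congrArg Subtype.val h)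
  obtain ⟨k, w, huk⟩ := IsDiscreteValuationRing.eq_unit_mul_pow_irreducible huO0 hϖ
  have hw0K : ((w : padicCoeffRing K) : K) ≠ 0 := fun h ↦ (w.isUnit.ne_zero) (Subtype.ext h)
  have hwA1 : ‖(((w : padicCoeffRing K) : K) : PadicAlgCl p)‖ = 1 :=
    (isUnit_padicCoeffRing_iff K _).mp w.isUnit
  have huKw : uK = ((w : padicCoeffRing K) : K) * ((ϖ : padicCoeffRing K) : K) ^ k := by
    have h : ((uO : padicCoeffRing K) : K) = (((w * ϖ ^ k : padicCoeffRing K)) : K) := by rw [huk]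
    push_cast at h
    exact h
  have hke : 12 * k = v * e := by
    have h : ‖((uK : K) : PadicAlgCl p)‖ ^ 12 =
        ‖((((w : padicCoeffRing K) : K) * ((ϖ : padicCoeffRing K) : K) ^ k : K) : PadicAlgCl p)‖ ^ 12 := by
      rw [← huKw]
    change ‖u₀‖ ^ 12 = _ at h
    push_cast at h
    rw [hnu₀12, norm_mul, norm_pow, hwA1, one_mul, ← pow_mul, ← hπe, ← pow_mul] at h
    have h' := pow_right_injective₀ hϖpos hϖlt.ne h
    linarith
  /- the `O`-curve `V''` -/
  have hnA₁u : ‖((A₁K / uK : K) : PadicAlgCl p)‖ ≤ 1 := by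
    have : ((A₁K / uK : K) : PadicAlgCl p) = ((A₁K : K) : PadicAlgCl p) / ((uK : K) : PadicAlgCl p) := by
      push_cast; ring
    rw [this, hA₁KA, norm_div]
    change ‖A₁‖ / ‖u₀‖ ≤ 1
    rw [div_le_one (norm_pos_iff.mpr hu₀0)]
    exact hnA₁
  have hnDu : ‖((DK / uK ^ 3 : K) : PadicAlgCl p)‖ = 1 := by
    have : ((DK / uK ^ 3 : K) : PadicAlgCl p) = ((DK : K) : PadicAlgCl p) / ((uK : K) : PadicAlgCl p) ^ 3 := by
      push_cast; ring
    rw [this, hDKA, norm_div, norm_pow]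
    change ‖D‖ / ‖u₀‖ ^ 3 = 1
    rw [hnu₀D, div_self (norm_pos_iff.mpr hD0).ne']
  set A1u : padicCoeffRing K := ⟨A₁K / uK, (mem_padicCoeffRing_iff K _).mpr hnA₁u⟩ with hA1u
  set A3u : padicCoeffRing K := ⟨DK / uK ^ 3, (mem_padicCoeffRing_iff K _).mpr hnDu.le⟩ with hA3u
  set wO : padicCoeffRing K := (w : padicCoeffRing K) with hwO
  set V'' : WeierstrassCurve (padicCoeffRing K) := ⟨wO * A1u, 0, wO ^ 3 * A3u, 0, 0⟩ with hV''
  set πu : Kˣ := Units.mk0 ((ϖ : padicCoeffRing K) : K) hϖ0 with hπu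
  set ϖA : PadicAlgCl p := (((ϖ : padicCoeffRing K) : K) : PadicAlgCl p) with hϖA
  set wA : PadicAlgCl p := (((w : padicCoeffRing K) : K) : PadicAlgCl p) with hwA
  have hwA0 : wA ≠ 0 := fun h ↦ hw0K (by rw [hwA] at h; exact_mod_cast h)
  have hu₀w : u₀ = wA * ϖA ^ k := by
    have h : ((uK : K) : PadicAlgCl p) =
        ((((w : padicCoeffRing K) : K) * ((ϖ : padicCoeffRing K) : K) ^ k : K) : PadicAlgCl p) := by
      rw [← huKw]
    push_cast at h
    exact h
  have hϖAk0 : ϖA ^ k ≠ 0 := pow_ne_zero _ hϖA0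
  -- over `ℚ̄_p`: `(ϖᵏ, x₀, s₀, y₀) = (w⁻¹, 0, 0, 0)·(u₀, x₀, s₀, y₀)`
  have hCA : (⟨Units.mk0 (ϖA ^ k) hϖAk0, x₀, s₀, y₀⟩ : VariableChange (PadicAlgCl p)) =
      ⟨(Units.mk0 wA hwA0)⁻¹, 0, 0, 0⟩ * ⟨Units.mk0 u₀ hu₀0, x₀, s₀, y₀⟩ := by
    rw [VariableChange.mul_def]
    simp only [zero_mul, zero_add, mul_zero, add_zero]
    congr 1
    apply Units.ext
    simp only [Units.val_mul, Units.val_inv_eq_inv_val, Units.val_mk0]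
    rw [hu₀w, ← mul_assoc, inv_mul_cancel₀ hwA0, one_mul]
  have hVA' : (⟨Units.mk0 (ϖA ^ k) hϖAk0, x₀, s₀, y₀⟩ : VariableChange (PadicAlgCl p)) • W'A =
      ⟨wA * (u₀⁻¹ * A₁), 0, wA ^ 3 * (u₀⁻¹ ^ 3 * D), 0, 0⟩ := by
    rw [hCA, mul_smul]
    change (⟨(Units.mk0 wA hwA0)⁻¹, 0, 0, 0⟩ : VariableChange (PadicAlgCl p)) •
      ((⟨Units.mk0 u₀ hu₀0, x₀, s₀, y₀⟩ : VariableChange (PadicAlgCl p)) • W'.map (algebraMap ℚ (PadicAlgCl p))) = _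
    rw [hVA, uScale_smul_deuringForm]
    simp only [Units.val_inv_eq_inv_val, Units.val_mk0, inv_inv]
  set rO : padicCoeffRing K := ⟨x₀K, (mem_padicCoeffRing_iff K _).mpr hnx₀⟩ with hrO
  set sO : padicCoeffRing K := ⟨sK, (mem_padicCoeffRing_iff K _).mpr (by rw [hsKA]; exact hns₀)⟩ with hsO
  set tO : padicCoeffRing K := ⟨y₀K, (mem_padicCoeffRing_iff K _).mpr hny₀⟩ with htO
  have hV''K : V''.map (algebraMap (padicCoeffRing K) K) =
      (⟨πu ^ k, (rO : K), (sO : K), (tO : K)⟩ : VariableChange K) • W'K := by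
    apply WeierstrassCurve.map_injective hjAinj
    change (V''.map (algebraMap (padicCoeffRing K) K)).map jA =
      ((⟨πu ^ k, (rO : K), (sO : K), (tO : K)⟩ : VariableChange K) • W'K).map jA
    rw [← map_variableChange, hW'KA]
    have hCmap : (⟨πu ^ k, (rO : K), (sO : K), (tO : K)⟩ : VariableChange K).map jA =
        ⟨Units.mk0 (ϖA ^ k) hϖAk0, x₀, s₀, y₀⟩ := by
      change (⟨Units.map (jA : K →* PadicAlgCl p) (πu ^ k), jA (rO : K), jA (sO : K), jA (tO : K)⟩ :
        VariableChange (PadicAlgCl p)) = _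
      have hu' : Units.map (jA : K →* PadicAlgCl p) (πu ^ k) = Units.mk0 (ϖA ^ k) hϖAk0 := by
        apply Units.ext
        rw [Units.coe_map, Units.val_mk0, Units.val_pow_eq_pow_val, hπu, Units.val_mk0, MonoidHom.coe_coe,
          map_pow, hjA']
      rw [hu', hjA', hjA', hjA']
      change (⟨Units.mk0 (ϖA ^ k) hϖAk0, x₀, ((sK : K) : PadicAlgCl p), y₀⟩ : VariableChange (PadicAlgCl p)) = _
      rw [hsKA]
    rw [hCmap, hVA', WeierstrassCurve.map_map]
    have hc1 : ((jA.comp (algebraMap (padicCoeffRing K) K)) (wO * A1u)) = wA * (u₀⁻¹ * A₁) := by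
      rw [RingHom.comp_apply, hjA']
      change ((((wO * A1u : padicCoeffRing K)) : K) : PadicAlgCl p) = wA * (u₀⁻¹ * A₁)
      push_cast
      rw [← hwA, show ((A1u : padicCoeffRing K) : K) = A₁K / uK from rfl]
      have : ((A₁K / uK : K) : PadicAlgCl p) = ((A₁K : K) : PadicAlgCl p) / ((uK : K) : PadicAlgCl p) := by
        push_cast; ring
      rw [this, hA₁KA]
      change wA * (A₁ / u₀) = wA * (u₀⁻¹ * A₁)
      ring
    have hc3 : ((jA.comp (algebraMap (padicCoeffRing K) K)) (wO ^ 3 * A3u)) = wA ^ 3 * (u₀⁻¹ ^ 3 * D) := by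
      rw [RingHom.comp_apply, hjA']
      change ((((wO ^ 3 * A3u : padicCoeffRing K)) : K) : PadicAlgCl p) = wA ^ 3 * (u₀⁻¹ ^ 3 * D)
      push_cast
      rw [← hwA, show ((A3u : padicCoeffRing K) : K) = DK / uK ^ 3 from rfl]
      have : ((DK / uK ^ 3 : K) : PadicAlgCl p) = ((DK : K) : PadicAlgCl p) / ((uK : K) : PadicAlgCl p) ^ 3 := by
        push_cast; ring
      rw [this, hDKA]
      change wA ^ 3 * (D / u₀ ^ 3) = wA ^ 3 * (u₀⁻¹ ^ 3 * D)
      ring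
    have hc0 : ((jA.comp (algebraMap (padicCoeffRing K) K)) 0) = 0 := map_zero _
    ext
    · exact hc1
    · exact hc0
    · exact hc3
    · exact hc0
    · exact hc0
  /- `Δ(V'') = w¹²` -/
  have hunit : IsUnit V''.Δ := by
    rw [isUnit_padicCoeffRing_iff K]
    -- compare with `Δ` of the `ℚ̄_p`-model
    have hΔK : (V''.map (algebraMap (padicCoeffRing K) K)).Δ =
        ((πu ^ k : Kˣ) : K)⁻¹ ^ 12 * W'K.Δ := by
      rw [hV''K, variableChange_Δ, Units.val_inv_eq_inv_val]
    rw [WeierstrassCurve.map_Δ, WeierstrassCurve.map_Δ, Units.val_pow_eq_pow_val, hπu, Units.val_mk0] at hΔK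
    change ((V''.Δ : padicCoeffRing K) : K) = _ at hΔK
    have h : ‖(((V''.Δ : padicCoeffRing K) : K) : PadicAlgCl p)‖ =
        ‖((((((ϖ : padicCoeffRing K) : K) ^ k)⁻¹ ^ 12 * φQ W'.Δ : K)) : PadicAlgCl p)‖ := by rw [hΔK]
    have e1 : ((((((ϖ : padicCoeffRing K) : K) ^ k)⁻¹ ^ 12 * φQ W'.Δ : K)) : PadicAlgCl p) =
        (ϖA ^ (k * 12))⁻¹ * ((φQ W'.Δ : K) : PadicAlgCl p) := by
      push_cast; rw [← hϖA]; ring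
    rw [h, e1, norm_mul, norm_inv, norm_pow, hnormQ, hv, ← hπe, ← pow_mul, mul_comm k 12, hke, mul_comm v e,
      inv_mul_cancel₀ (pow_ne_zero _ hϖpos.ne')]
  refine ⟨K, hKfd, πu, e, k, rO, sO, tO, V'', ?_, he0, h12e, hke, hV''K, hunit, rfl, rfl, rfl⟩
  rw [hπu, Units.val_mk0]
  exact hπe

end TwistB


/-! ### Characteristic `2`: the height dichotomy on a Deuring-shaped model -/

section CharTwo

open PowerSeries

variable {S : Type*} [Field S] [CharP S 2] (V : WeierstrassCurve S)

/-- `[z²][2](z) = a₁` in characteristic `2` (the tree's `coeff_two_formalMul_two = −a₁`).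
[cite: SilvermanAEC2009, IV.2.3] -/
theorem coeff_two_formalMul_two_of_char_two : coeff 2 (V.formalMul 2) = V.a₁ := by
  rw [V.coeff_two_formalMul_two]
  linear_combination (-V.a₁) * CharP.cast_eq_zero S 2

/-- On a Deuring-shaped model `y² + a₁xy + a₃y = x³` with `Δ ≠ 0` and `a₁ = 0` in characteristic
`2`: `a₃ ≠ 0` and `[z⁴][2] = a₁a₂ − 7a₃ = a₃ ≠ 0` (the supersingular case, height `2` with unit
coefficient in degree `4`). [cite: SilvermanAEC2009, IV.2.3, Appendix A Prop. 1.3] -/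
theorem coeff_four_formalMul_two_ne_zero (ha₁ : V.a₁ = 0) (ha₂ : V.a₂ = 0) (ha₄ : V.a₄ = 0)
    (ha₆ : V.a₆ = 0) (hΔ : V.Δ ≠ 0) : coeff 4 (V.formalMul 2) ≠ 0 := by
  have ha₃ : V.a₃ ≠ 0 := by
    intro h
    apply hΔ
    simp only [WeierstrassCurve.Δ, WeierstrassCurve.b₂, WeierstrassCurve.b₄, WeierstrassCurve.b₆,
      WeierstrassCurve.b₈, ha₁, ha₂, ha₄, ha₆, h]
    ring
  rw [V.coeff_four_formalMul_two, ha₁, ha₂, mul_zero, zero_sub, neg_ne_zero, mul_ne_zero_iff]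
  refine ⟨?_, ha₃⟩
  intro h7
  have h1 : (1 : S) = 0 := by linear_combination h7 - 3 * CharP.cast_eq_zero S 2
  exact one_ne_zero h1

end CharTwo

/-! ### `‖A₁‖¹² = ‖j‖` on a Deuring model with `v(j) < 12` (residue characteristic `2`) -/

section UltraTwo

variable {F : Type*} [NormedField F] [IsUltrametricDist F]

/-- On an integral Deuring model `y² + A₁xy + A₃y = x³` with unit discriminant over a `2`-adic
field, `j = A₁³(A₁³ − 24A₃)³/Δ`: if `‖2‖¹² < ‖j‖` then `‖A₁‖ > ‖2‖`, `‖A₁³ − 24A₃‖ = ‖A₁‖³` and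
`‖j‖ = ‖A₁‖¹²`. [cite: SilvermanAEC2009, Appendix A Prop. 1.3] -/
theorem norm_pow_twelve_eq_of_deuring {A₁ A₃ : F} {J : ℝ} (h3 : ‖(3 : F)‖ = 1) (hA₃ : ‖A₃‖ ≤ 1)
    (hJ : J = ‖A₁ * (A₁ ^ 3 - 24 * A₃)‖ ^ 3) (hbig : ‖(2 : F)‖ ^ 12 < J) :
    ‖A₁‖ ^ 12 = J := by
  have h24 : ‖(24 : F) * A₃‖ ≤ ‖(2 : F)‖ ^ 3 := by
    rw [norm_mul, show (24 : F) = 2 ^ 3 * 3 by norm_num, norm_mul, norm_pow, h3, mul_one]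
    exact mul_le_of_le_one_right (by positivity) hA₃
  have hgt : ‖(2 : F)‖ < ‖A₁‖ := by
    by_contra hle
    rw [not_lt] at hle
    have hc : ‖A₁ * (A₁ ^ 3 - 24 * A₃)‖ ≤ ‖(2 : F)‖ ^ 4 := by
      rw [norm_mul, show ‖(2 : F)‖ ^ 4 = ‖(2 : F)‖ * ‖(2 : F)‖ ^ 3 by ring]
      refine mul_le_mul hle ((norm_sub_le_max_of_isUltrametricDist _ _).trans (max_le ?_ h24))
        (norm_nonneg _) (norm_nonneg _)
      rw [norm_pow]; exact pow_le_pow_left₀ (norm_nonneg _) hle 3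
    have : J ≤ ‖(2 : F)‖ ^ 12 := by
      rw [hJ, show (12 : ℕ) = 4 * 3 from rfl, pow_mul]
      exact pow_le_pow_left₀ (norm_nonneg _) hc 3
    linarith
  have hsub : ‖A₁ ^ 3 - 24 * A₃‖ = ‖A₁‖ ^ 3 := by
    rw [← norm_pow]
    refine norm_eq_of_norm_sub_lt' ?_
    rw [sub_sub_cancel_left, norm_neg, norm_pow]
    exact h24.trans_lt (pow_lt_pow_left₀ hgt (norm_nonneg _) three_ne_zero)
  rw [hJ, norm_mul, hsub, ← pow_succ', ← pow_mul]

end UltraTwo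

/-! ### `‖q‖₂ ≤ 1` at a potentially good additive prime `2`; the fact -/

section Two

open scoped IntermediateField
open Literature.NumberTheory.GaloisRepresentations IsLocalRing
open Literature.NumberTheory.EllipticCurves.ModularForms Literature.NumberTheory.Automorphic
open scoped MatrixGroups ModularForm
open CongruenceSubgroup PowerSeries

set_option maxHeartbeats 4000000 in
/-- **`‖q‖₂ ≤ 1` at an additive prime `2` of potentially good reduction** (`‖j‖₂ ≤ 1`). With
`v = v₂(Δ_min)`, `m = v₂(c₄)` and the Deuring twist `(K, π, e, k, V'')`
(`exists_deuringTwist_of_norm_j_le_one`: `12 ∣ e`, `12k = ve`, `V''` of Deuring shape with good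
reduction): (A) if `ā₁'' ≠ 0` (ordinary) then `[z²][2]_{V''}` is a unit and `k < 2e` because
`v ≤ 23` (Kraus); (B) if `ā₁'' = 0` and `v < 16` then `[z⁴][2]_{V''} = ā₃''` is a unit and
`3k < 4e`; (C) if `ā₁'' = 0` and `v ≥ 16` then Kraus gives `m ≤ 7`, `v₂(j) = 3m − v ≤ 5 < 12`, so
`‖a₁''‖¹² = ‖j‖₂` (`norm_pow_twelve_eq_of_deuring`), i.e. `‖a₁''‖ = ‖π‖^{e(3m − v)/12}`, and the
vertex `(j, v') = (2, e(3m − v)/12)` of the Newton-polygon ender satisfies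
`k + v' < 2e ⇔ 3m < 24`. [cite: EdixhovenManin1991, Prop. 2]
[cite: SilvermanAEC2009, IV.2.3, VII.5.4, VII.5.5, Ex. 7.1, Appendix A Prop. 1.3] -/
theorem padicNorm_le_one_of_neronLattice_eq_smul_periodLattice_of_norm_j_le_one_two
    {N : ℕ} [NeZero N]
    {W' : WeierstrassCurve ℚ} [W'.IsElliptic] [W'.IsGloballyMinimal] {f : CuspForm (Gamma0 N) 2}
    {L' : PeriodPair} (hf : IsNewformOf W' f) (hL' : IsNeronLatticeOf (W'.baseChange ℂ) L')
    {q : ℚ} (hq : ∀ z ∈ periodLattice f, (q : ℂ) * z ∈ L'.lattice)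
    (hq' : ∀ z ∈ L'.lattice, ∃ w ∈ periodLattice f, z = q * w)
    [hp : Fact (Nat.Prime 2)]
    (hΔ : (2 : ℤ) ∣ minimalDiscriminantInt W') (hc₄ : (2 : ℤ) ∣ (integralModelInt W').c₄)
    (hj : ‖((W'.j : ℚ) : ℚ_[2])‖ ≤ 1) : ‖(q : ℚ_[2])‖ ≤ 1 := by
  classical
  set v := padicValInt 2 (minimalDiscriminantInt W') with hv_def
  have hv := norm_Δ_eq_inv_pow_padicValInt W' (p := 2)
  obtain ⟨K, hK, πu, e, k, r, s, t, V'', hπe, he, h12e, hke, hV'', hunit, ha₂, ha₄, ha₆⟩ :=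
    exists_deuringTwist_of_norm_j_le_one (p := 2) (by norm_num) W' hj hv
  haveI := hK
  have h2R : ((2 : ℕ) : ℝ)⁻¹ = (2 : ℝ)⁻¹ := by norm_num
  -- numerics from Kraus and `‖j‖ ≤ 1`
  have hjΔ : ((W'.j : ℚ) : ℚ_[2]) * ((W'.Δ : ℚ) : ℚ_[2]) = ((W'.c₄ : ℚ) : ℚ_[2]) ^ 3 := by
    exact_mod_cast j_mul_Δ_eq_c₄_pow W'
  have hc₄norm : ‖((W'.c₄ : ℚ) : ℚ_[2])‖ ^ 3 ≤ ((2 : ℕ) : ℝ)⁻¹ ^ v := by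
    rw [← norm_pow, ← hjΔ, norm_mul, hv]
    exact mul_le_of_le_one_left (by positivity) hj
  -- `v ≥ 16 → c₄ ≠ 0 ∧ v₂(c₄) ≤ 7 ∧ v ≤ 3 v₂(c₄)`
  have hbig : 16 ≤ v → (integralModelInt W').c₄ ≠ 0 ∧ padicValInt 2 (integralModelInt W').c₄ ≤ 7 ∧
      v ≤ 3 * padicValInt 2 (integralModelInt W').c₄ := by
    intro h16
    have hK2 := not_pow_dvd_c₄_minimalDiscriminantInt_two W'
    have hΔ16 : (2 : ℤ) ^ 16 ∣ minimalDiscriminantInt W' := (padicValInt_dvd_iff 16 _).mpr (Or.inr h16)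
    have hc₄0 : (integralModelInt W').c₄ ≠ 0 := by
      intro h0; exact hK2 ⟨by rw [h0]; exact dvd_zero _, hΔ16⟩
    have hm7 : padicValInt 2 (integralModelInt W').c₄ ≤ 7 := by
      by_contra hcon
      exact hK2 ⟨(padicValInt_dvd_iff 8 _).mpr (Or.inr (not_le.mp hcon)), hΔ16⟩
    refine ⟨hc₄0, hm7, ?_⟩
    have hm := norm_c₄_eq_inv_pow_padicValInt W' (p := 2) hc₄0
    rw [hm, ← pow_mul] at hc₄norm
    by_contra hcon
    rw [not_le] at hcon
    have := (pow_lt_pow_iff_right_of_lt_one₀ (by positivity)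
      (inv_lt_one_of_one_lt₀ (by norm_num : (1 : ℝ) < (2 : ℕ)))).mpr
      (by generalize padicValInt 2 (integralModelInt W').c₄ = m at hcon ⊢; omega :
        padicValInt 2 (integralModelInt W').c₄ * 3 < v)
    linarith
  have hv23 : v ≤ 23 := by
    by_contra hcon
    obtain ⟨-, hm7, hv3⟩ := hbig (by omega)
    omega
  -- the residue of `V''`
  letI hOloc : IsLocalRing (padicCoeffRing K) := isLocalRing_padicCoeffRing K
  letI hOch : CharP (ResidueField (padicCoeffRing K)) 2 := charP_residueField_padicCoeffRing K
  set Vr := V''.map (residue (padicCoeffRing K)) with hVr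
  have hΔr : Vr.Δ ≠ 0 := by
    rw [hVr, map_Δ]; exact (residue_ne_zero_iff_isUnit _).mpr hunit
  have hra₂ : Vr.a₂ = 0 := by change residue _ V''.a₂ = 0; rw [ha₂, map_zero]
  have hra₄ : Vr.a₄ = 0 := by change residue _ V''.a₄ = 0; rw [ha₄, map_zero]
  have hra₆ : Vr.a₆ = 0 := by change residue _ V''.a₆ = 0; rw [ha₆, map_zero]
  have hcoeffres : ∀ n, residue (padicCoeffRing K) (coeff n (V''.formalMul 2)) = coeff n (Vr.formalMul 2) := by
    intro n; rw [← PowerSeries.coeff_map, map_formalMul, ← hVr]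
  by_cases hra₁ : Vr.a₁ = 0
  · -- supersingular reduction: unit coefficient in degree `4`
    have h4 : IsUnit (coeff 4 (V''.formalMul 2)) := by
      rw [← residue_ne_zero_iff_isUnit, hcoeffres]
      exact coeff_four_formalMul_two_ne_zero Vr hra₁ hra₂ hra₄ hra₆ hΔr
    by_cases hv16 : v < 16
    · -- (B): `J = 4`, `3k < 4e`
      refine padicNorm_le_one_of_neronLattice_eq_smul_periodLattice_of_semistableTwist_sharp hf hL' hq hq'
        (p := 2) (by exact_mod_cast hΔ) (by exact_mod_cast hc₄) K πu hπe r s t V'' hV'' ⟨4, by norm_num, h4, ?_⟩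
      have h1 : 3 * (12 * k) < 48 * e := by
        rw [hke, ← mul_assoc]
        exact Nat.mul_lt_mul_of_pos_right (by omega) he
      omega
    · -- (C): vertex `(2, e(3m − v)/12)`
      rw [not_lt] at hv16
      obtain ⟨hc₄0, hm7, hv3m⟩ := hbig hv16
      set m := padicValInt 2 (integralModelInt W').c₄ with hm_def
      have hm := norm_c₄_eq_inv_pow_padicValInt W' (p := 2) hc₄0
      obtain ⟨e', he'⟩ := h12e
      -- `‖j‖₂ = 2^{-(3m - v)}`
      have hjnorm : ‖((W'.j : ℚ) : ℚ_[2])‖ = ((2 : ℕ) : ℝ)⁻¹ ^ (3 * m - v) := by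
        have hΔn0 : ‖((W'.Δ : ℚ) : ℚ_[2])‖ ≠ 0 := by rw [hv]; positivity
        have h := congrArg (fun x ↦ ‖x‖) hjΔ
        simp only [norm_mul, norm_pow] at h
        rw [hv, hm, ← pow_mul] at h
        -- h : ‖j‖ * 2⁻¹^v = 2⁻¹^(m*3)
        have e1 : ((2 : ℕ) : ℝ)⁻¹ ^ (m * 3) = ((2 : ℕ) : ℝ)⁻¹ ^ (3 * m - v) * ((2 : ℕ) : ℝ)⁻¹ ^ v := by
          rw [← pow_add]; congr 1; omega
        rw [e1] at h
        exact mul_right_cancel₀ (by positivity) h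
      -- `‖a₁''‖¹² = ‖j‖₂` on the Deuring model `V''`
      set φQ : ℚ →+* K := algebraMap ℚ K with hφQ
      have hnormQ : ∀ x : ℚ, ‖((φQ x : K) : PadicAlgCl 2)‖ = ‖(x : ℚ_[2])‖ := fun x ↦ by
        have hφQ' : φQ x = algebraMap ℚ_[2] K (x : ℚ_[2]) := by
          rw [hφQ]
          have : (algebraMap ℚ_[2] K).comp (algebraMap ℚ ℚ_[2]) = algebraMap ℚ K :=
            RingHom.ext fun y ↦ by rw [eq_ratCast, eq_ratCast]
          rw [← this, RingHom.comp_apply, eq_ratCast]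
        rw [hφQ', IntermediateField.coe_algebraMap_apply, PadicAlgCl.norm_extends]
      have hjV : φQ W'.j * (V''.map (algebraMap (padicCoeffRing K) K)).Δ =
          (V''.map (algebraMap (padicCoeffRing K) K)).c₄ ^ 3 := by
        have h :=
          j_mul_Δ_eq_c₄_pow ((⟨πu ^ k, (r : K), (s : K), (t : K)⟩ : VariableChange K) • W'.map φQ)
        rw [WeierstrassCurve.variableChange_j, show (W'.map φQ).j = φQ W'.j from W'.map_j φQ] at h
        rw [hφQ, ← hV''] at h
        exact h
      rw [WeierstrassCurve.map_Δ, WeierstrassCurve.map_c₄] at hjV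
      have hc₄V : V''.c₄ = V''.a₁ * (V''.a₁ ^ 3 - 24 * V''.a₃) := by
        rw [WeierstrassCurve.c₄, WeierstrassCurve.b₂, WeierstrassCurve.b₄, ha₂, ha₄]; ring
      set a1A : PadicAlgCl 2 := (((V''.a₁ : padicCoeffRing K) : K) : PadicAlgCl 2) with ha1A
      set a3A : PadicAlgCl 2 := (((V''.a₃ : padicCoeffRing K) : K) : PadicAlgCl 2) with ha3A
      have hΔ1 : ‖(((V''.Δ : padicCoeffRing K) : K) : PadicAlgCl 2)‖ = 1 :=
        (isUnit_padicCoeffRing_iff K _).mp hunit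
      have hjA : ‖((W'.j : ℚ) : ℚ_[2])‖ = ‖a1A * (a1A ^ 3 - 24 * a3A)‖ ^ 3 := by
        rw [hc₄V] at hjV
        have h : ‖(((φQ W'.j * ((V''.Δ : padicCoeffRing K) : K)) : K) : PadicAlgCl 2)‖ =
            ‖(((((V''.a₁ * (V''.a₁ ^ 3 - 24 * V''.a₃) : padicCoeffRing K)) : K) ^ 3 : K) : PadicAlgCl 2)‖ := by
          have hjV' : φQ W'.j * ((V''.Δ : padicCoeffRing K) : K) =
              (((V''.a₁ * (V''.a₁ ^ 3 - 24 * V''.a₃) : padicCoeffRing K)) : K) ^ 3 := hjV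
          rw [hjV']
        have e1 : (((φQ W'.j * ((V''.Δ : padicCoeffRing K) : K)) : K) : PadicAlgCl 2) =
            ((φQ W'.j : K) : PadicAlgCl 2) * (((V''.Δ : padicCoeffRing K) : K) : PadicAlgCl 2) := by
          push_cast; ring
        have h24 : ((((24 : padicCoeffRing K) : padicCoeffRing K) : K) : PadicAlgCl 2) = 24 := by
          rw [show (24 : padicCoeffRing K) = (1 + 1) ^ 3 * (1 + 1 + 1) by norm_num]
          push_cast; norm_num
        have e2 : (((((V''.a₁ * (V''.a₁ ^ 3 - 24 * V''.a₃) : padicCoeffRing K)) : K) ^ 3 : K) : PadicAlgCl 2) =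
            (a1A * (a1A ^ 3 - 24 * a3A)) ^ 3 := by
          push_cast
          rw [h24]
        rw [e1, e2, norm_mul, hΔ1, mul_one, hnormQ, norm_pow] at h
        exact h
      have h3A : ‖(3 : PadicAlgCl 2)‖ = 1 := by
        rw [← map_ofNat (algebraMap ℚ_[2] (PadicAlgCl 2)) 3]
        change ‖((3 : ℚ_[2]) : PadicAlgCl 2)‖ = 1
        rw [PadicAlgCl.norm_extends, show (3 : ℚ_[2]) = ((3 : ℕ) : ℚ_[2]) by norm_num,
          Padic.norm_natCast_eq_one_iff]
        norm_num
      have h2A : ‖(2 : PadicAlgCl 2)‖ = (2 : ℝ)⁻¹ := by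
        rw [← map_ofNat (algebraMap ℚ_[2] (PadicAlgCl 2)) 2]
        change ‖((2 : ℚ_[2]) : PadicAlgCl 2)‖ = (2 : ℝ)⁻¹
        rw [PadicAlgCl.norm_extends, show (2 : ℚ_[2]) = ((2 : ℕ) : ℚ_[2]) by norm_num, Padic.norm_p]
        norm_num
      have ha3le : ‖a3A‖ ≤ 1 := norm_coe_padicCoeffRing_le K _
      have hpow12 : ‖a1A‖ ^ 12 = ((2 : ℕ) : ℝ)⁻¹ ^ (3 * m - v) := by
        refine norm_pow_twelve_eq_of_deuring h3A ha3le (hjnorm ▸ hjA) ?_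
        rw [h2A, ← h2R]
        exact pow_lt_pow_right_of_lt_one₀ (by positivity) (by norm_num) (by omega)
      -- `‖a₁''‖ = ‖π‖^{e'(3m − v)}` with `e = 12e'`
      have hρ : ‖((πu : K) : PadicAlgCl 2)‖ ^ (e' * (3 * m - v)) = ‖a1A‖ := by
        have h1 : (‖((πu : K) : PadicAlgCl 2)‖ ^ (e' * (3 * m - v))) ^ 12 = ‖a1A‖ ^ 12 := by
          rw [hpow12, ← pow_mul, show e' * (3 * m - v) * 12 = e * (3 * m - v) by rw [he']; ring, pow_mul,
            hπe]
        exact (pow_left_inj₀ (by positivity) (norm_nonneg _) (by norm_num)).mp h1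
      have hcoeff2 : (((coeff 2 (V''.formalMul 2) : padicCoeffRing K) : K) : PadicAlgCl 2) = -a1A := by
        rw [V''.coeff_two_formalMul_two]; push_cast; rfl
      refine padicNorm_le_one_of_neronLattice_eq_smul_periodLattice_of_semistableTwist_vertex hf hL' hq hq'
        (p := 2) (by exact_mod_cast hΔ) (by exact_mod_cast hc₄) K πu hπe r s t V'' hV'' ⟨4, by norm_num, h4⟩
        (j := 2) (v := e' * (3 * m - v)) (by norm_num) (by rw [hcoeff2, norm_neg, hρ]) ?_
      -- `k + e'(3m − v) < 2e` iff `3m < 24`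
      obtain ⟨d, hd⟩ := Nat.exists_eq_add_of_le hv3m
      have hsub : 3 * m - v = d := by omega
      have he'0 : 0 < e' := by
        rcases Nat.eq_zero_or_pos e' with h0 | h0
        · rw [h0, mul_zero] at he'; omega
        · exact h0
      have hk : k = e' * v := by
        apply Nat.eq_of_mul_eq_mul_left (by norm_num : 0 < 12)
        rw [hke, he']; ring
      rw [hsub, hk, he']
      calc (2 - 1) * (e' * v) + e' * d = e' * (3 * m) := by rw [hd]; ring
        _ < e' * 24 := Nat.mul_lt_mul_of_pos_left (by omega) he'0
        _ = 2 * (12 * e') := by ring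
  · -- (A): ordinary reduction, `J = 2`, `k < 2e`
    have h2 : IsUnit (coeff 2 (V''.formalMul 2)) := by
      rw [← residue_ne_zero_iff_isUnit, hcoeffres, coeff_two_formalMul_two_of_char_two Vr]
      exact hra₁
    refine padicNorm_le_one_of_neronLattice_eq_smul_periodLattice_of_semistableTwist_sharp hf hL' hq hq'
      (p := 2) (by exact_mod_cast hΔ) (by exact_mod_cast hc₄) K πu hπe r s t V'' hV'' ⟨2, by norm_num, h2, ?_⟩
    have h1 : 12 * k < 24 * e := by
      rw [hke]
      exact Nat.mul_lt_mul_of_pos_right (by omega) he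
    omega

/-- **`‖q‖₂ ≤ 1` at an ADDITIVE prime `2`, unconditionally** (potentially good: above;
potentially multiplicative: `…_of_one_lt_norm_j_two` of `ManinConstantPotMultiplicativeProofs`).
[cite: EdixhovenManin1991, Prop. 2] -/
theorem padicNorm_le_one_of_neronLattice_eq_smul_periodLattice_of_additive_two
    {N : ℕ} [NeZero N]
    {W' : WeierstrassCurve ℚ} [W'.IsElliptic] [W'.IsGloballyMinimal] {f : CuspForm (Gamma0 N) 2}
    {L' : PeriodPair} (hf : IsNewformOf W' f) (hL' : IsNeronLatticeOf (W'.baseChange ℂ) L')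
    {q : ℚ} (hq : ∀ z ∈ periodLattice f, (q : ℂ) * z ∈ L'.lattice)
    (hq' : ∀ z ∈ L'.lattice, ∃ w ∈ periodLattice f, z = q * w)
    [hp : Fact (Nat.Prime 2)]
    (hΔ : (2 : ℤ) ∣ minimalDiscriminantInt W') (hc₄ : (2 : ℤ) ∣ (integralModelInt W').c₄) :
    ‖(q : ℚ_[2])‖ ≤ 1 := by
  rcases le_or_gt ‖((W'.j : ℚ) : ℚ_[2])‖ 1 with hj | hj
  · exact padicNorm_le_one_of_neronLattice_eq_smul_periodLattice_of_norm_j_le_one_two hf hL' hq hq'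
      hΔ hc₄ hj
  · exact padicNorm_le_one_of_neronLattice_eq_smul_periodLattice_of_one_lt_norm_j_two hf hL' hq hq'
      hΔ hc₄ hj

/-- **Edixhoven 1991, Prop. 2 — the fact `edixhoven_int_of_neronLattice_eq_smul_periodLattice`
HOLDS:** for a globally minimal elliptic `W'/ℚ` with a newform `f` and a Néron period pair whose
lattice is exactly `q·Λ_f`, `q ∈ ℤ`. Proof (entirely through the formal group of `W'`, prime by
prime: `den q` has no prime factor): good and multiplicative primes
(`ManinConstantFiniteHeightPrimesProofs`), additive `p ≥ 5` (`ManinConstantAdditivePrimesProofs`),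
additive `3` (`ManinConstantLegendreTwistProofs`), additive `2` (this file), assembled by
`edixhoven_int_of_neronLattice_eq_smul_periodLattice_of_additive_two`.
[cite: EdixhovenManin1991, Prop. 2] [cite: AgasheRibetStein2006, Thm. 2.2] -/
theorem edixhoven_int_of_neronLattice_eq_smul_periodLattice_holds :
    edixhoven_int_of_neronLattice_eq_smul_periodLattice :=
  edixhoven_int_of_neronLattice_eq_smul_periodLattice_of_additive_two
    (fun hf hL' _ hq hq' hΔ hc₄ ↦ by
      haveI : Fact (Nat.Prime 2) := ⟨Nat.prime_two⟩
      exact padicNorm_le_one_of_neronLattice_eq_smul_periodLattice_of_additive_two hf hL' hq hq' hΔ hc₄)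

/-- **The `ModularForms`-namespace twin of the fact holds as well** (one statement, two names:
`edixhoven_int_of_neronLattice_eq_smul_periodLattice_iff_optimalManinConstant_integral`).
[cite: EdixhovenManin1991, Prop. 2] [cite: AgasheRibetStein2006, Thm. 2.2] -/
theorem ModularForms.edixhoven_optimalManinConstant_integral_holds :
    ModularForms.edixhoven_optimalManinConstant_integral :=
  ModularForms.edixhoven_optimalManinConstant_integral_of
    edixhoven_int_of_neronLattice_eq_smul_periodLattice_holds

end Two

end Literature.NumberTheory.EllipticCurves
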